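import Literature.Analysis.FluidPDE.KochTataruKernel
import Literature.Analysis.FunctionSpaces.GaussianSchwartz
import Literature.Analysis.UnboundedOperators.HeatFlowCalculus
import HarnessLib

/-!
# The Fourier symbol of the Oseen–Koch–Tataru kernel

Analysis/FluidPDE proof companion of `Literature/Analysis/FluidPDE/KochTataru.lean` (the
decomposition of the named fact `Literature.Analysis.FluidPDE.koch_tataru`, **ns.S15**,
Koch–Tataru, Adv. Math. 157 (2001), Theorem 2). The Carleson (`L²`) half of Koch–Tataru's
Lemma 3.2 for the explicit bilinear operator `B(u, v) = kochTataruBilinear u v` — the `L²` estimate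
(13), proved in the paper through (15)–(18) or Remark 3.3 — rests on two pieces of structure of
the operator `V∇Π` that the pointwise kernel bound (14) does not see: "`Π` is a bounded operator in
`L²` and commutes with `∇V`" (Step 3) and the energy identity behind (17)/(21). Both are statements
about the **Fourier symbol** of the kernel, which this file computes for the tree's explicit
Gaussian-weight kernel `K(τ, z)[a, b] = oseenKernel τ z a b` (everything **proved**):

* `iteratedFDeriv_three_heatKernel_apply`: the third derivative of the Gauss–Weierstrass kernel,
  `D³G_s(y)[a, w, b] = G_s(y) ((⟪y,a⟫⟪b,w⟫ + ⟪a,b⟫⟪y,w⟫ + ⟪y,b⟫⟪a,w⟫)/(4s²) - ⟪y,a⟫⟪y,b⟫⟪y,w⟫/(8s³))`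
  (three nested Fréchet derivatives, `fderiv_fderiv_fderiv_heatKernel_apply`, and the passage
  from nested to iterated derivatives, `iteratedFDeriv_three_apply`);
* `inner_oseenKernel_eq` (**the gradient structure of the kernel**, Koch–Tataru 2001, §2,
  (5)–(8)): `⟪K(τ, z)[a, b], w⟫ = ∂_aG_τ(z) ⟪b, w⟫ + ∫_τ^∞ D³G_s(z)[a, w, b] ds` for `τ > 0` — the
  Gaussian weights `A = ∫_τ^∞ G_s/(4s²)`, `B = ∫_τ^∞ G_s/(8s³)` of `oseenKernel` are exactly the
  coefficients of `D³G_s`, i.e. `K = D_a(G_τ b) - D_a∇D_b(Δ⁻¹G_τ)` with `Δ⁻¹G_τ = -∫_τ^∞ G_s ds`;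
* `fourier_inner_oseenKernel` (**the symbol**, Koch–Tataru 2001, §2, (6) and (8)): in Mathlib's
  normalisation `𝓕 f(ξ) = ∫ e^{-2πi⟪z,ξ⟫} f(z) dz`, for `τ > 0`,
  `𝓕 (z ↦ ⟪K(τ, z)[a, b], w⟫)(ξ) = 2πi ⟪ξ, a⟫ e^{-(2π)²τ‖ξ‖²} (⟪b, w⟫ - ⟪ξ, b⟫⟪ξ, w⟫/‖ξ‖²)`, that is
  `K̂(τ, ξ)[a, b] = 2πi⟪ξ, a⟫ Ĝ_τ(ξ) P(ξ)b` with the Leray symbol `P(ξ) = 1 - ξ ⊗ ξ/|ξ|²` (the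
  tree's `leraySymbol`); from the Fourier transform of the derivatives of the heat kernel
  (`Literature.Analysis.FunctionSpaces.fourier_iteratedFDeriv_heatKernel_apply_ofReal`), Fubini in
  `(s, z)` (`integrable_iteratedFDeriv_three_heatKernel_prod`: `‖D³G_s‖_{L¹} = s^{-3/2}‖D³G_1‖_{L¹}`
  is integrable on `(τ, ∞)`) and `∫_τ^∞ e^{-(2π)²s|ξ|²} ds = e^{-(2π)²τ|ξ|²}/((2π)²|ξ|²)`.

Consequences used downstream (the near-field `L²` estimate): `|K̂(τ,ξ)[a,b]·w| ≤ 2π|ξ||a|Ĝ_τ(ξ)|b||w|`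
uniformly (`|P(ξ)| ≤ 1`), linearity of the symbol in `a` and `b`, and the exact time dependence
`Ĝ_τ(ξ) = e^{-λτ}`, `λ = (2π)²|ξ|²`, which turns `∫₀ᵀ ‖B(u,v)(t)‖²_{L²} dt` into the
one-dimensional energy identity of Koch–Tataru's Step 4.

## Mathlib / tree search

Tree: `UnboundedOperators.hasFDerivAt_heatKernel` (`HeatKernelGradient`),
`UnboundedOperators.fderiv_heatKernel_apply_eq_mul_inner` (`HeatFlowCalculus`),
`FunctionSpaces.contDiff_heatKernel'`, `fourier_iteratedFDeriv_heatKernel_apply_ofReal`,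
`integrable_iteratedFDeriv_heatKernel(_apply_ofReal)`, `integral_norm_iteratedFDeriv_heatKernel_eq`,
`continuousOn_iteratedFDeriv_heatKernel_uncurry` (`GaussianSchwartz`), `exists_oseenWeightA/B_le`,
`exists_lintegral_enorm_oseenKernel_le` (`KochTataruKernel`). Mathlib: `iteratedFDeriv_succ_apply_right`,
`iteratedFDeriv_two_apply`, `fderiv_clm_apply`, `HasFDerivAt.mul/const_mul/mul_const/sub_const`,
`Real.fourier_eq`, `Real.fourierIntegral_convergent_iff`, `integral_integral_swap`,
`integrable_prod_iff`, `integral_exp_mul_Ioi`, `Circle.smul_def`, `Circle.norm_smul`.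
Nothing is duplicated (`lean search 'iteratedFDeriv_three|fourier_inner_oseen|inner_oseenKernel_eq'`).

## References

* H. Koch, D. Tataru, *Well-posedness for the Navier–Stokes equations*, Adv. Math. 157 (2001)
  22–35, §2 ((5)–(8): the multiplier `δ_{ij} - η_iη_j/|η|²` of `Π`, the kernels of `ΠS(t)` and
  `Π∇S(t)`), §3 ((11), (13)–(18), Remark 3.3). Bib key `KochTataruAdvMath2001` (held:
  doi:10.1006/aima.2000.1937, pp. 5–9 of the preprint).
-/

noncomputable section

open MeasureTheory Set Function Filter Topology Metric Real
open scoped ENNReal NNReal RealInnerProductSpace FourierTransform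

namespace Literature.Analysis.FluidPDE

open UnboundedOperators (heatKernel heatSymbol)

variable {E : Type*} [NormedAddCommGroup E] [InnerProductSpace ℝ E]

/-! ## The first three derivatives of the Gauss–Weierstrass kernel -/

section Derivatives

/-- The derivative of `y ↦ ∂_b G_s(y)`:
`∂_w ∂_b G_s(y) = G_s(y) (⟪y, b⟫⟪y, w⟫/(4s²) - ⟪b, w⟫/(2s))`, as a Fréchet derivative. [folklore] -/
theorem hasFDerivAt_fderiv_heatKernel_apply (s : ℝ) (b y : E) :
    HasFDerivAt (fun y' => fderiv ℝ (heatKernel s) y' b)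
      ((-(heatKernel s y / (2 * s))) • innerSL ℝ b +
        ⟪y, b⟫ • ((-(1 / (2 * s))) • ((-(heatKernel s y / (2 * s))) • innerSL ℝ y))) y := by
  have hfun : (fun y' => fderiv ℝ (heatKernel s) y' b) =
      fun y' => (-(heatKernel s y' / (2 * s))) * ⟪y', b⟫ :=
    funext fun y' => UnboundedOperators.fderiv_heatKernel_apply_eq_mul_inner s y' b
  rw [hfun]
  have hG := UnboundedOperators.hasFDerivAt_heatKernel s y
  have hp : HasFDerivAt (fun y' => -(heatKernel s y' / (2 * s)))
      ((-(1 / (2 * s))) • ((-(heatKernel s y / (2 * s))) • innerSL ℝ y)) y := by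
    refine (hG.const_mul (-(1 / (2 * s)))).congr_of_eventuallyEq
      (Eventually.of_forall fun y' => ?_)
    simp only
    ring
  have hq : HasFDerivAt (fun y' : E => ⟪y', b⟫) (innerSL ℝ b) y := by
    refine (innerSL ℝ b).hasFDerivAt.congr_of_eventuallyEq (Eventually.of_forall fun y' => ?_)
    simp only [innerSL_apply_apply, real_inner_comm]
  exact hp.mul hq

/-- `∂_w ∂_b G_s(y) = G_s(y) (⟪y, b⟫⟪y, w⟫/(4s²) - ⟪b, w⟫/(2s))` (`s ≠ 0`). [folklore] -/
theorem fderiv_fderiv_heatKernel_apply {s : ℝ} (hs : s ≠ 0) (b w y : E) :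
    fderiv ℝ (fun y' => fderiv ℝ (heatKernel s) y' b) y w =
      heatKernel s y * (⟪y, b⟫ * ⟪y, w⟫ / (4 * s ^ 2) - ⟪b, w⟫ / (2 * s)) := by
  rw [(hasFDerivAt_fderiv_heatKernel_apply s b y).fderiv]
  simp [innerSL_apply_apply]
  field_simp
  ring

/-- The derivative of `y ↦ ∂_w ∂_b G_s(y)`, as a Fréchet derivative (`s ≠ 0`). [folklore] -/
theorem hasFDerivAt_fderiv_fderiv_heatKernel_apply {s : ℝ} (hs : s ≠ 0) (b w y : E) :
    HasFDerivAt (fun y' => fderiv ℝ (fun y'' => fderiv ℝ (heatKernel s) y'' b) y' w)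
      (heatKernel s y • ((⟪y, w⟫ / (4 * s ^ 2)) • innerSL ℝ b + (⟪y, b⟫ / (4 * s ^ 2)) • innerSL ℝ w) +
        (⟪y, b⟫ * ⟪y, w⟫ / (4 * s ^ 2) - ⟪b, w⟫ / (2 * s)) •
          ((-(heatKernel s y / (2 * s))) • innerSL ℝ y)) y := by
  have hfun : (fun y' => fderiv ℝ (fun y'' => fderiv ℝ (heatKernel s) y'' b) y' w) =
      fun y' => heatKernel s y' * (⟪y', b⟫ * ⟪y', w⟫ / (4 * s ^ 2) - ⟪b, w⟫ / (2 * s)) :=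
    funext fun y' => fderiv_fderiv_heatKernel_apply hs b w y'
  rw [hfun]
  have hG := UnboundedOperators.hasFDerivAt_heatKernel s y
  have hqb : HasFDerivAt (fun y' : E => ⟪y', b⟫) (innerSL ℝ b) y := by
    refine (innerSL ℝ b).hasFDerivAt.congr_of_eventuallyEq (Eventually.of_forall fun y' => ?_)
    simp only [innerSL_apply_apply, real_inner_comm]
  have hqw : HasFDerivAt (fun y' : E => ⟪y', w⟫) (innerSL ℝ w) y := by
    refine (innerSL ℝ w).hasFDerivAt.congr_of_eventuallyEq (Eventually.of_forall fun y' => ?_)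
    simp only [innerSL_apply_apply, real_inner_comm]
  have hr : HasFDerivAt (fun y' : E => ⟪y', b⟫ * ⟪y', w⟫ / (4 * s ^ 2) - ⟪b, w⟫ / (2 * s))
      ((⟪y, w⟫ / (4 * s ^ 2)) • innerSL ℝ b + (⟪y, b⟫ / (4 * s ^ 2)) • innerSL ℝ w) y := by
    have h := ((hqb.mul hqw).mul_const (4 * s ^ 2)⁻¹).sub_const (⟪b, w⟫ / (2 * s))
    have hfun' : (fun y' : E => ⟪y', b⟫ * ⟪y', w⟫ / (4 * s ^ 2) - ⟪b, w⟫ / (2 * s)) =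
        fun y' => ⟪y', b⟫ * ⟪y', w⟫ * (4 * s ^ 2)⁻¹ - ⟪b, w⟫ / (2 * s) := by
      funext y'; ring
    rw [hfun']
    refine h.congr_fderiv ?_
    ext z
    simp [innerSL_apply_apply]
    ring
  exact hG.mul hr

/-- **The third derivative of the Gauss–Weierstrass kernel**:
`∂_a ∂_w ∂_b G_s(y) = G_s(y) ((⟪y,a⟫⟪b,w⟫ + ⟪a,b⟫⟪y,w⟫ + ⟪y,b⟫⟪a,w⟫)/(4s²) - ⟪y,a⟫⟪y,b⟫⟪y,w⟫/(8s³))`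
(`s ≠ 0`; Koch–Tataru 2001, §2, (6)–(8): the kernel of `Π∇S(t)`). [cite: KochTataruAdvMath2001, §2 (6)–(8)] -/
theorem fderiv_fderiv_fderiv_heatKernel_apply {s : ℝ} (hs : s ≠ 0) (a b w y : E) :
    fderiv ℝ (fun y' => fderiv ℝ (fun y'' => fderiv ℝ (heatKernel s) y'' b) y' w) y a =
      heatKernel s y * ((⟪y, a⟫ * ⟪b, w⟫ + ⟪a, b⟫ * ⟪y, w⟫ + ⟪y, b⟫ * ⟪a, w⟫) / (4 * s ^ 2) -
        ⟪y, a⟫ * ⟪y, b⟫ * ⟪y, w⟫ / (8 * s ^ 3)) := by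
  rw [(hasFDerivAt_fderiv_fderiv_heatKernel_apply hs b w y).fderiv]
  simp [innerSL_apply_apply]
  rw [real_inner_comm a b, real_inner_comm a w, real_inner_comm a y]
  field_simp
  ring

/-- **Iterated versus nested derivatives, order three**: for a `C³` function,
`D³f(x)[m₀, m₁, m₂] = ∂_{m₀} ∂_{m₁} ∂_{m₂} f (x)` with the innermost derivative taken first.
[folklore] -/
theorem iteratedFDeriv_three_apply {F : Type*} [NormedAddCommGroup F] [NormedSpace ℝ F]
    {f : E → F} (hf : ContDiff ℝ 3 f) (x m₀ m₁ m₂ : E) :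
    iteratedFDeriv ℝ 3 f x ![m₀, m₁, m₂] =
      fderiv ℝ (fun y => fderiv ℝ (fun y' => fderiv ℝ f y' m₂) y m₁) x m₀ := by
  -- differentiability of `Df` and `D(Df)`
  have h2 : ContDiff ℝ 2 (fun y => fderiv ℝ f y) := hf.fderiv_right (by norm_num)
  have h1 : ContDiff ℝ 1 (fun y => fderiv ℝ (fun y => fderiv ℝ f y) y) :=
    h2.fderiv_right (by norm_num)
  have hg : Differentiable ℝ (fun y => fderiv ℝ f y) := h2.differentiable (by norm_num)
  have hG1 : Differentiable ℝ (fun y => fderiv ℝ (fun y => fderiv ℝ f y) y) :=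
    h1.differentiable (by norm_num)
  rw [iteratedFDeriv_succ_apply_right]
  have hinit : Fin.init ![m₀, m₁, m₂] = ![m₀, m₁] := by
    funext i
    fin_cases i <;> rfl
  have hlast : ![m₀, m₁, m₂] (Fin.last 2) = m₂ := rfl
  rw [hinit, hlast, iteratedFDeriv_two_apply]
  simp only [Matrix.cons_val_zero, Matrix.cons_val_one]
  -- commute the evaluations with the derivatives
  have hC : ∀ y, fderiv ℝ (fun y => fderiv ℝ f y) y m₁ m₂ =
      fderiv ℝ (fun y' => fderiv ℝ f y' m₂) y m₁ := by
    intro y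
    rw [fderiv_clm_apply (hg y) (differentiableAt_const m₂), fderiv_const_apply]
    simp
  have hA : fderiv ℝ (fun y => fderiv ℝ (fun y => fderiv ℝ f y) y) x m₀ m₁ =
      fderiv ℝ (fun y => fderiv ℝ (fun y => fderiv ℝ f y) y m₁) x m₀ := by
    rw [fderiv_clm_apply (hG1 x) (differentiableAt_const m₁), fderiv_const_apply]
    simp
  have hdiff : DifferentiableAt ℝ (fun y => fderiv ℝ (fun y => fderiv ℝ f y) y m₁) x :=
    (hG1 x).clm_apply (differentiableAt_const m₁)
  have hB : fderiv ℝ (fun y => fderiv ℝ (fun y => fderiv ℝ f y) y m₁) x m₀ m₂ =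
      fderiv ℝ (fun y => fderiv ℝ (fun y => fderiv ℝ f y) y m₁ m₂) x m₀ := by
    rw [fderiv_clm_apply hdiff (differentiableAt_const m₂), fderiv_const_apply]
    simp
  rw [hA, hB]
  simp_rw [hC]

/-- **The third derivative of the heat kernel as an iterated derivative**:
`D³G_s(y)[a, w, b] = G_s(y) ((⟪y,a⟫⟪b,w⟫ + ⟪a,b⟫⟪y,w⟫ + ⟪y,b⟫⟪a,w⟫)/(4s²) - ⟪y,a⟫⟪y,b⟫⟪y,w⟫/(8s³))`
(`s ≠ 0`). [cite: KochTataruAdvMath2001, §2 (6)–(8)] -/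
theorem iteratedFDeriv_three_heatKernel_apply {s : ℝ} (hs : s ≠ 0) (a b w y : E) :
    iteratedFDeriv ℝ 3 (heatKernel s) y ![a, w, b] =
      heatKernel s y * ((⟪y, a⟫ * ⟪b, w⟫ + ⟪a, b⟫ * ⟪y, w⟫ + ⟪y, b⟫ * ⟪a, w⟫) / (4 * s ^ 2) -
        ⟪y, a⟫ * ⟪y, b⟫ * ⟪y, w⟫ / (8 * s ^ 3)) := by
  rw [iteratedFDeriv_three_apply (FunctionSpaces.contDiff_heatKernel' s) y a w b]
  exact fderiv_fderiv_fderiv_heatKernel_apply hs a b w y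

end Derivatives

/-! ## The kernel as a heat-kernel derivative plus a time integral of third derivatives -/

section KernelIdentity

/-- **The gradient structure of the Oseen–Koch–Tataru kernel** (Koch–Tataru 2001, §2, (5)–(8):
the kernel of `e^{τΔ}Π∇·` is `D_a` of `G_τ δ - ∇² Δ⁻¹G_τ`, `Δ⁻¹G_τ = -∫_τ^∞ G_s ds`): for `τ > 0`,
`⟪K(τ, z)[a, b], w⟫ = ∂_a G_τ(z) ⟪b, w⟫ + ∫_τ^∞ D³G_s(z)[a, w, b] ds`, the Gaussian weights
`A`, `B` of `oseenKernel` being exactly the coefficients of the third derivative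
(`iteratedFDeriv_three_heatKernel_apply`). [cite: KochTataruAdvMath2001, §2 (5)–(8)] -/
theorem inner_oseenKernel_eq {τ : ℝ} (hτ : 0 < τ) (z a b w : E) :
    ⟪oseenKernel τ z a b, w⟫ = fderiv ℝ (heatKernel τ) z a * ⟪b, w⟫ +
      ∫ s in Ioi τ, iteratedFDeriv ℝ 3 (heatKernel s) z ![a, w, b] := by
  obtain ⟨_, -, hA⟩ := exists_oseenWeightA_le (E := E)
  obtain ⟨_, -, hB⟩ := exists_oseenWeightB_le (E := E)
  have hintA : IntegrableOn (fun s => heatKernel s z / (4 * s ^ 2)) (Ioi τ) := (hA hτ z).1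
  have hintB : IntegrableOn (fun s => heatKernel s z / (8 * s ^ 3)) (Ioi τ) := (hB hτ z).1
  set Q₁ : ℝ := ⟪z, a⟫ * ⟪b, w⟫ + ⟪a, b⟫ * ⟪z, w⟫ + ⟪z, b⟫ * ⟪a, w⟫ with hQ₁
  set Q₂ : ℝ := ⟪z, a⟫ * ⟪z, b⟫ * ⟪z, w⟫ with hQ₂
  -- the time integral of the third derivatives, in terms of the weights
  have hD3 : ∫ s in Ioi τ, iteratedFDeriv ℝ 3 (heatKernel s) z ![a, w, b] =
      oseenWeightA τ z * Q₁ - oseenWeightB τ z * Q₂ := by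
    have heq : ∀ s ∈ Ioi τ, iteratedFDeriv ℝ 3 (heatKernel s) z ![a, w, b] =
        heatKernel s z / (4 * s ^ 2) * Q₁ - heatKernel s z / (8 * s ^ 3) * Q₂ := by
      intro s hs
      have hs0 : s ≠ 0 := (hτ.trans hs).ne'
      rw [iteratedFDeriv_three_heatKernel_apply hs0, hQ₁, hQ₂]
      field_simp
    rw [setIntegral_congr_fun measurableSet_Ioi heq, integral_sub (hintA.mul_const _)
      (hintB.mul_const _), integral_mul_const, integral_mul_const]
    rfl
  rw [hD3, UnboundedOperators.fderiv_heatKernel_apply_eq_mul_inner]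
  simp only [oseenKernel, inner_sub_left, inner_add_left, inner_smul_left, RCLike.conj_to_real,
    hQ₁, hQ₂]
  ring

end KernelIdentity

/-! ## The Fourier symbol -/

section Fourier

variable [FiniteDimensional ℝ E] [MeasurableSpace E] [BorelSpace E]

/-- The entries `z ↦ ⟪K(τ, z)[a, b], w⟫` of the Oseen–Koch–Tataru kernel are integrable (`τ > 0`;
Koch–Tataru 2001, (14)). [cite: KochTataruAdvMath2001, §3 (14)] -/
theorem integrable_inner_oseenKernel {τ : ℝ} (hτ : 0 < τ) (a b w : E) :
    Integrable (fun z : E => ((⟪oseenKernel τ z a b, w⟫ : ℝ) : ℂ)) := by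
  obtain ⟨_, -, hK⟩ := exists_lintegral_enorm_oseenKernel_le (E := E)
  exact ((hK hτ a b).1.inner_const w).ofReal

/-- The time integrand `(s, z) ↦ D³G_s(z)[a, w, b]` is integrable on `(τ, ∞) × E` for `τ > 0`
(`‖D³G_s‖_{L¹} = s^{-3/2} ‖D³G_1‖_{L¹}`). [folklore] -/
theorem integrable_iteratedFDeriv_three_heatKernel_prod {τ : ℝ} (hτ : 0 < τ) (a b w : E) :
    Integrable (fun p : ℝ × E => iteratedFDeriv ℝ 3 (heatKernel p.1) p.2 ![a, w, b])
      (((volume : Measure ℝ).restrict (Ioi τ)).prod (volume : Measure E)) := by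
  set m : Fin 3 → E := ![a, w, b] with hm
  set M : ℝ := ∫ x : E, ‖iteratedFDeriv ℝ 3 (heatKernel 1) x‖ with hM
  -- joint measurability, from joint continuity on `(0, ∞) × E`
  have hcont : ContinuousOn (fun p : ℝ × E => iteratedFDeriv ℝ 3 (heatKernel p.1) p.2 m)
      (Ioi τ ×ˢ univ) := by
    have h := FunctionSpaces.continuousOn_iteratedFDeriv_heatKernel_uncurry (E := E) 3
    have h' : ContinuousOn (fun p : ℝ × E => iteratedFDeriv ℝ 3 (heatKernel p.1) p.2 m)
        (Ioi 0 ×ˢ univ) :=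
      (ContinuousMultilinearMap.apply ℝ (fun _ : Fin 3 => E) ℝ m).continuous.comp_continuousOn h
    exact h'.mono (prod_mono (Ioi_subset_Ioi hτ.le) subset_rfl)
  have hmeas : AEStronglyMeasurable (fun p : ℝ × E => iteratedFDeriv ℝ 3 (heatKernel p.1) p.2 m)
      (((volume : Measure ℝ).restrict (Ioi τ)).prod (volume : Measure E)) := by
    have hμ : ((volume : Measure ℝ).restrict (Ioi τ)).prod (volume : Measure E) =
        (volume : Measure (ℝ × E)).restrict (Ioi τ ×ˢ univ) := by
      rw [show (volume : Measure (ℝ × E)) = (volume : Measure ℝ).prod (volume : Measure E) from rfl,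
        ← Measure.restrict_univ (μ := (volume : Measure E)), Measure.prod_restrict,
        Measure.restrict_univ]
    rw [hμ]
    exact hcont.aestronglyMeasurable (measurableSet_Ioi.prod MeasurableSet.univ)
  refine (integrable_prod_iff hmeas).2 ⟨?_, ?_⟩
  · refine (ae_restrict_iff' measurableSet_Ioi).2 (Eventually.of_forall fun s hs => ?_)
    have hs0 : 0 < s := hτ.trans hs
    exact ((FunctionSpaces.integrable_iteratedFDeriv_heatKernel hs0 3).norm.mul_const
      (∏ i, ‖m i‖)).mono' ((ContinuousMultilinearMap.apply ℝ (fun _ : Fin 3 => E) ℝ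
        m).continuous.comp (FunctionSpaces.continuous_iteratedFDeriv_heatKernel s 3)
        |>.aestronglyMeasurable) (Eventually.of_forall fun x =>
          (iteratedFDeriv ℝ 3 (heatKernel s) x).le_opNorm m)
  · -- `s ↦ ∫ ‖D³G_s(z)[m]‖ dz ≤ (∏ ‖mᵢ‖) M s^{-3/2}`, integrable on `(τ, ∞)`
    have hg_meas : AEStronglyMeasurable
        (fun s => ∫ z : E, ‖iteratedFDeriv ℝ 3 (heatKernel s) z m‖)
        ((volume : Measure ℝ).restrict (Ioi τ)) := hmeas.norm.integral_prod_right'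
    have hdom : IntegrableOn (fun s : ℝ => (∏ i, ‖m i‖) * M * s ^ (-(3 / 2 : ℝ))) (Ioi τ) :=
      ((integrableOn_Ioi_rpow_of_lt (by norm_num) hτ).const_mul _)
    refine hdom.mono' hg_meas ((ae_restrict_iff' measurableSet_Ioi).2
      (Eventually.of_forall fun s hs => ?_))
    have hs0 : 0 < s := hτ.trans hs
    rw [Real.norm_of_nonneg (integral_nonneg fun _ => norm_nonneg _)]
    have hpow : (Real.sqrt s)⁻¹ ^ 3 = s ^ (-(3 / 2 : ℝ)) := by
      rw [Real.sqrt_eq_rpow, ← Real.rpow_neg_one, ← Real.rpow_mul hs0.le, ← Real.rpow_natCast,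
        ← Real.rpow_mul hs0.le]
      norm_num
    calc ∫ z : E, ‖iteratedFDeriv ℝ 3 (heatKernel s) z m‖
        ≤ ∫ z : E, ‖iteratedFDeriv ℝ 3 (heatKernel s) z‖ * ∏ i, ‖m i‖ :=
          integral_mono_of_nonneg (Eventually.of_forall fun _ => norm_nonneg _)
            ((FunctionSpaces.integrable_iteratedFDeriv_heatKernel hs0 3).norm.mul_const _)
            (Eventually.of_forall fun x => (iteratedFDeriv ℝ 3 (heatKernel s) x).le_opNorm m)
      _ = (∏ i, ‖m i‖) * M * s ^ (-(3 / 2 : ℝ)) := by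
          rw [integral_mul_const, FunctionSpaces.integral_norm_iteratedFDeriv_heatKernel_eq hs0 3,
            hpow, hM]
          ring

omit [InnerProductSpace ℝ E] [FiniteDimensional ℝ E] [MeasurableSpace E] [BorelSpace E] in
/-- `∫_τ^∞ e^{-(2π)² s ‖ξ‖²} ds = e^{-(2π)² τ ‖ξ‖²} / ((2π)² ‖ξ‖²)` for `ξ ≠ 0`. [folklore] -/
theorem integral_heatSymbol_Ioi (τ : ℝ) {ξ : E} (hξ : ξ ≠ 0) :
    ∫ s in Ioi τ, heatSymbol s ξ = heatSymbol τ ξ / ((2 * π) ^ 2 * ‖ξ‖ ^ 2) := by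
  have hc : -((2 * π) ^ 2 * ‖ξ‖ ^ 2) < 0 := by
    have : 0 < ‖ξ‖ := norm_pos_iff.2 hξ
    have : 0 < (2 * π) ^ 2 * ‖ξ‖ ^ 2 := by positivity
    linarith
  have hfun : (fun s : ℝ => heatSymbol s ξ) = fun s => Real.exp (-((2 * π) ^ 2 * ‖ξ‖ ^ 2) * s) := by
    funext s
    rw [heatSymbol]
    congr 1
    ring
  rw [hfun, integral_exp_mul_Ioi hc, heatSymbol]
  rw [show -((2 * π) ^ 2 * ‖ξ‖ ^ 2) * τ = -(2 * π) ^ 2 * τ * ‖ξ‖ ^ 2 by ring]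
  field_simp

/-- **The Fourier symbol of the Oseen–Koch–Tataru kernel** (Koch–Tataru 2001, §2, (6) and (8):
`Π` is the Fourier multiplier `δ_{ij} - η_iη_j/|η|²`, and `K` is the kernel of `Π∇S(t)`): for
`τ > 0` and `a, b, w ∈ E`, in Mathlib's normalisation `𝓕 f (ξ) = ∫ e^{-2πi⟪z, ξ⟫} f(z) dz`,
`𝓕 (z ↦ ⟪K(τ, z)[a, b], w⟫) (ξ) = 2πi ⟪ξ, a⟫ e^{-(2π)² τ ‖ξ‖²} (⟪b, w⟫ - ⟪ξ, b⟫⟪ξ, w⟫/‖ξ‖²)`,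
i.e. `K̂(τ, ξ)[a, b] = 2πi ⟪ξ, a⟫ Ĝ_τ(ξ) P(ξ) b` with the Leray symbol `P(ξ) = 1 - ξ ⊗ ξ/|ξ|²`
(at `ξ = 0` both sides vanish). Proof: `inner_oseenKernel_eq`, the Fourier transform of the
derivatives of the heat kernel (`fourier_iteratedFDeriv_heatKernel_apply_ofReal`), Fubini in
`(s, z)` and `∫_τ^∞ e^{-(2π)²s|ξ|²} ds = e^{-(2π)²τ|ξ|²}/((2π)²|ξ|²)`. [cite: KochTataruAdvMath2001, §2 (6)–(8)] -/
theorem fourier_inner_oseenKernel {τ : ℝ} (hτ : 0 < τ) (a b w ξ : E) :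
    𝓕 (fun z : E => ((⟪oseenKernel τ z a b, w⟫ : ℝ) : ℂ)) ξ =
      2 * π * Complex.I * (⟪ξ, a⟫ : ℝ) * (heatSymbol τ ξ : ℝ) *
        ((⟪b, w⟫ - ⟪ξ, b⟫ * ⟪ξ, w⟫ / ‖ξ‖ ^ 2 : ℝ) : ℂ) := by
  set m : Fin 3 → E := ![a, w, b] with hm
  -- the two pieces of the kernel
  set f₁ : E → ℂ := fun z => ((fderiv ℝ (heatKernel τ) z a * ⟪b, w⟫ : ℝ) : ℂ) with hf₁
  set f₂ : E → ℂ := fun z => ((∫ s in Ioi τ, iteratedFDeriv ℝ 3 (heatKernel s) z m : ℝ) : ℂ)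
    with hf₂
  have hsplit : (fun z : E => ((⟪oseenKernel τ z a b, w⟫ : ℝ) : ℂ)) = f₁ + f₂ := by
    funext z
    simp only [Pi.add_apply, hf₁, hf₂, inner_oseenKernel_eq hτ z a b w, Complex.ofReal_add, hm]
  -- piece 1: a first derivative of the heat kernel
  have hf₁_eq : f₁ = fun z => (⟪b, w⟫ : ℂ) *
      ((iteratedFDeriv ℝ 1 (heatKernel τ) z ![a] : ℝ) : ℂ) := by
    funext z
    simp only [hf₁, iteratedFDeriv_one_apply, Matrix.cons_val_zero, Complex.ofReal_mul]
    ring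
  have hint₁' : Integrable (fun z : E => ((iteratedFDeriv ℝ 1 (heatKernel τ) z ![a] : ℝ) : ℂ)) :=
    FunctionSpaces.integrable_iteratedFDeriv_heatKernel_apply_ofReal hτ 1 ![a]
  have hint₁ : Integrable f₁ := by
    rw [hf₁_eq]; exact hint₁'.const_mul _
  have hF₁ : 𝓕 f₁ ξ = (⟪b, w⟫ : ℂ) * (2 * π * Complex.I * (⟪ξ, a⟫ : ℂ) * (heatSymbol τ ξ : ℂ)) := by
    rw [hf₁_eq]
    have h := FunctionSpaces.fourier_iteratedFDeriv_heatKernel_apply_ofReal hτ 1 ![a] ξ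
    simp only [Fin.prod_univ_one, Matrix.cons_val_zero, pow_one] at h
    rw [← h, Real.fourier_eq, Real.fourier_eq, ← integral_const_mul]
    congr 1 with z
    simp only [Circle.smul_def, smul_eq_mul]
    ring
  -- piece 2: Fubini in `(s, z)`
  have hprod := integrable_iteratedFDeriv_three_heatKernel_prod hτ a b w
  have hchar : Continuous fun p : ℝ × E => 𝐞 (-⟪p.2, ξ⟫) :=
    Real.continuous_fourierChar.comp (by fun_prop)
  have hprodC : Integrable (uncurry fun (s : ℝ) (z : E) =>
      𝐞 (-⟪z, ξ⟫) • ((iteratedFDeriv ℝ 3 (heatKernel s) z m : ℝ) : ℂ))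
      (((volume : Measure ℝ).restrict (Ioi τ)).prod (volume : Measure E)) := by
    refine (hprod.ofReal (𝕜 := ℂ)).norm.mono' (hchar.aestronglyMeasurable.smul (hprod.ofReal (𝕜 := ℂ)).1)
      (Eventually.of_forall fun p => ?_)
    simp only [uncurry, Circle.norm_smul]
    exact le_rfl
  have hint₂ : Integrable f₂ := by
    rw [hf₂]
    exact (hprod.integral_prod_right).ofReal (𝕜 := ℂ)
  have hF₂ : 𝓕 f₂ ξ = (2 * π * Complex.I) ^ 3 * ((⟪ξ, a⟫ : ℂ) * (⟪ξ, w⟫ : ℂ) * (⟪ξ, b⟫ : ℂ)) *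
      ((∫ s in Ioi τ, heatSymbol s ξ : ℝ) : ℂ) := by
    calc 𝓕 f₂ ξ = ∫ z, 𝐞 (-⟪z, ξ⟫) • ∫ s in Ioi τ,
          ((iteratedFDeriv ℝ 3 (heatKernel s) z m : ℝ) : ℂ) := by
          rw [Real.fourier_eq]
          congr 1 with z
          rw [hf₂, integral_complex_ofReal]
      _ = ∫ z, ∫ s in Ioi τ, 𝐞 (-⟪z, ξ⟫) • ((iteratedFDeriv ℝ 3 (heatKernel s) z m : ℝ) : ℂ) := by
          congr 1 with z
          simp_rw [Circle.smul_def]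
          exact (integral_smul _ _).symm
      _ = ∫ s in Ioi τ, ∫ z, 𝐞 (-⟪z, ξ⟫) • ((iteratedFDeriv ℝ 3 (heatKernel s) z m : ℝ) : ℂ) :=
          (integral_integral_swap hprodC).symm
      _ = ∫ s in Ioi τ, (2 * π * Complex.I) ^ 3 * ((⟪ξ, a⟫ : ℂ) * (⟪ξ, w⟫ : ℂ) * (⟪ξ, b⟫ : ℂ)) *
            (heatSymbol s ξ : ℂ) := by
          refine setIntegral_congr_fun measurableSet_Ioi fun s hs => ?_
          have hs0 : 0 < s := hτ.trans hs
          have h := FunctionSpaces.fourier_iteratedFDeriv_heatKernel_apply_ofReal hs0 3 m ξ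
          rw [Real.fourier_eq] at h
          rw [h, hm, Fin.prod_univ_three]
          simp
      _ = (2 * π * Complex.I) ^ 3 * ((⟪ξ, a⟫ : ℂ) * (⟪ξ, w⟫ : ℂ) * (⟪ξ, b⟫ : ℂ)) *
            ((∫ s in Ioi τ, heatSymbol s ξ : ℝ) : ℂ) := by
          rw [integral_const_mul, integral_complex_ofReal]
  -- assemble
  rw [hsplit]
  have hadd : 𝓕 (f₁ + f₂) ξ = 𝓕 f₁ ξ + 𝓕 f₂ ξ := by
    simp only [Real.fourier_eq, Pi.add_apply, smul_add]
    exact integral_add ((Real.fourierIntegral_convergent_iff ξ).2 hint₁)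
      ((Real.fourierIntegral_convergent_iff ξ).2 hint₂)
  rw [hadd, hF₁, hF₂]
  rcases eq_or_ne ξ 0 with rfl | hξ
  · simp
  · rw [integral_heatSymbol_Ioi τ hξ]
    have hξ' : (‖ξ‖ : ℂ) ≠ 0 := by exact_mod_cast (norm_pos_iff.2 hξ).ne'
    have hπ : (π : ℂ) ≠ 0 := by exact_mod_cast Real.pi_pos.ne'
    push_cast
    field_simp
    ring_nf
    simp only [Complex.I_sq]
    ring

omit [FiniteDimensional ℝ E] [MeasurableSpace E] [BorelSpace E] in
/-- The Leray symbol against a vector: `⟪P(ξ)b, w⟫ = ⟪b, w⟫ - ⟪ξ, b⟫⟪ξ, w⟫/‖ξ‖²`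
(Koch–Tataru 2001, §2, (6): `m(η) = δ_{ij} - η_iη_j/|η|²`). [cite: KochTataruAdvMath2001, §2 (6)] -/
theorem inner_leraySymbol_apply (ξ b w : E) :
    ⟪leraySymbol ξ b, w⟫ = ⟪b, w⟫ - ⟪ξ, b⟫ * ⟪ξ, w⟫ / ‖ξ‖ ^ 2 := by
  rw [leraySymbol_apply, inner_sub_left, inner_smul_left, inner_smul_left]
  simp only [conj_trivial]
  ring

omit [FiniteDimensional ℝ E] [MeasurableSpace E] [BorelSpace E] in
/-- **The Leray symbol is a contraction**: `‖P(ξ)v‖ ≤ ‖v‖` for all `ξ`, `v` (it is the orthogonal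
projection onto `ξ^⊥` for `ξ ≠ 0`, the identity for `ξ = 0`): `‖P(ξ)v‖² = ‖v‖² - ⟪ξ, v⟫²/‖ξ‖²`.
This is "`Π` is a bounded operator in `L²`" (Koch–Tataru 2001, §2, (5)–(6)). [cite: KochTataruAdvMath2001, §2 (5)–(6)] -/
theorem norm_leraySymbol_apply_le (ξ v : E) : ‖leraySymbol ξ v‖ ≤ ‖v‖ := by
  rcases eq_or_ne ξ 0 with rfl | hξ
  · simp [leraySymbol_apply]
  · have hξ2 : 0 < ‖ξ‖ ^ 2 := by positivity
    have hsq : ‖leraySymbol ξ v‖ ^ 2 = ‖v‖ ^ 2 - ⟪ξ, v⟫ ^ 2 / ‖ξ‖ ^ 2 := by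
      rw [leraySymbol_apply, ← smul_assoc, smul_eq_mul, norm_sub_sq_real, inner_smul_right,
        norm_smul, mul_pow, Real.norm_eq_abs, sq_abs, real_inner_comm v ξ]
      field_simp
      ring
    have hle : ‖leraySymbol ξ v‖ ^ 2 ≤ ‖v‖ ^ 2 := by
      rw [hsq]
      linarith [div_nonneg (sq_nonneg ⟪ξ, v⟫) hξ2.le]
    exact (sq_le_sq₀ (norm_nonneg _) (norm_nonneg _)).1 hle

/-- **The Fourier symbol of the Oseen–Koch–Tataru kernel, vector form**: for `τ > 0`,
`𝓕 (z ↦ ⟪K(τ, z)[a, b], w⟫)(ξ) = 2πi ⟪ξ, a⟫ e^{-(2π)²τ‖ξ‖²} ⟪P(ξ)b, w⟫` with the Leray symbol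
`P(ξ) = leraySymbol ξ` (Koch–Tataru 2001, §2, (6) and (8)). [cite: KochTataruAdvMath2001, §2 (6)–(8)] -/
theorem fourier_inner_oseenKernel_eq_leraySymbol {τ : ℝ} (hτ : 0 < τ) (a b w ξ : E) :
    𝓕 (fun z : E => ((⟪oseenKernel τ z a b, w⟫ : ℝ) : ℂ)) ξ =
      2 * π * Complex.I * (⟪ξ, a⟫ : ℝ) * (heatSymbol τ ξ : ℝ) * (⟪leraySymbol ξ b, w⟫ : ℝ) := by
  rw [fourier_inner_oseenKernel hτ, inner_leraySymbol_apply]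

end Fourier

end Literature.Analysis.FluidPDE
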